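import Literature.MathematicalPhysics.QuantumFieldTheory.Balaban1983to89.B12ActionExpansion26
import Literature.MathematicalPhysics.QuantumFieldTheory.Balaban1983to89.B9Eq3117Current
import Literature.MathematicalPhysics.QuantumFieldTheory.Balaban1983to89.B11Eq26ExpansionZpow

/-!
# `Balaban1983to89.B12ActionExpansion26Lattice` — [Balaban1987RG1] (2.6)–(2.8) p. 266 ON THE EXACT-BACKGROUND LATTICE OF
[13]: «the gauge invariance of the action» and «the formula (41) [15]» DISCHARGED as kernel theorems, (2.6)/(2.8) obtained from
the abstract record `B12ActionExpansion26` BY NAME at this dictionary, and the gauge invariance (2.16) of the remainder `V₀`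

HONEST FRAMING (cell `lit-balaban`, verbatim): statement-level skeleton of published theorems with citation tags; proofs where landed; nothing here is a claim about the Yang–Mills mass gap.

CITATION HEADER.  [I] = T. Bałaban, *Renormalization group approach to lattice gauge field theories. I. Generation of effective
actions in a small field approximation and a coupling constant renormalization in four dimensions*, Commun. Math. Phys. **109**
(1987) 249–301 [Balaban1987RG1] (cell paper B12; held text `paper:balaban1987-cmp109-rg-i-small-field`, journal page = PDF page
+ 248; p. 266 = PDF 18 re-read by this seat in the text layer, 2026-08-23/24; the displays were transcribed from the render
`b2b-balaban-ref1/pages/1987-cmp109-rg-I-small-field/…-p018-x2.png` by the gen-4 seat of this lineage, see `B12ActionExpansion26`).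
[15] = T. Bałaban, *The variational problem and background fields in renormalization group method for lattice gauge theories*,
Commun. Math. Phys. **102** (1985) 277–309 [Balaban1985Variational] (held `paper:balaban1985-cmp102-variational-background`,
journal page = PDF page + 276; p. 284 [PDF 8] L28 «(41)», p. 305 [PDF 29] L19 «(171)», L30 «(174)» re-read 2026-08-23/24).
[13] = T. Bałaban, *Propagators for lattice gauge theories in a background field*, Commun. Math. Phys. **99** (1985) 389–434
[Balaban1985BackgroundPropagators] ((3.1), (3.10)–(3.12) p. 390–392, (3.28)–(3.30) p. 395 (text layer p0004 L20–L29, p0007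
L20–L31 re-read 2026-08-24: «(3.12), and the gauge invariance of the action (3.1) implies that if we make the transformation
U → U^u, U′ → R(u)U′ (3.28) … A(R(u)U′U^u) = A((U′U)^u) = A(U′U) (3.29) … ⟨R(u)A, J(U^u)⟩ = ⟨A, J⟩, ⟨R(u)A, Δ(U^u)R(u)A⟩ =
⟨A, Δ(U)A⟩ (3.30)»), (3.127)–(3.129) p. 421 — the exact-background lattice files
`B9Eq39Adjoint`, `B9Eq310Hermitian` (pub-balaban cell, lineage pv27), `B9Eq3117Current`, `B9Eq31ActionZpow` (lit-balaban r06)).  Unit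
`lit-balaban-r09` gen 46 (reader/typer of B12, display owner; TAKING line HOME/STATUS.md 2026-08-23T23:58Z), SKELETON row
`B12.Eq2.6-2.8` (`typed-existing (+ p246376 …)`), HOME `run/shared/lean/pub/lit-balaban/`.

WHAT IS PRINTED ([I] p. 266, verbatim; the full display (2.6) is quoted in `B12ActionExpansion26`).  *«Now we analyze an expansion
of the action under the exponential in (2.1). Using the gauge invariance of the action, and the formulas (41), (174) [15] we have
A(U_k(V′V^{(k)})) = A(exp iη𝐇_k(B′)U_{k+1}) = A(U_{k+1}) + ⟨𝐇_k(B′), J_{k+1}⟩ + ½⟨𝐇_k(B′), Δ𝐇_k(B′)⟩ + V₀(𝐇_k(B′)) = A(U_{k+1})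
+ ⟨H_{1,k}B′ + 𝐀_{1,k}, J_{k+1}⟩ − ⟨H_kD_k(H_{1,k}B′ + 𝐀_{1,k}), J_{k+1}⟩ + ½⟨…⟩ − ⟨…⟩ + ½⟨…⟩ + V₀(…). (2.6)  Let us omit for
simplicity the subscript k. By Eq. (171) [15] we have ⟨𝐀₁, J⟩ = 0. In the third term on the right hand side above we decompose
the function D into the sum D^{(2)} + D₃, where D^{(2)} is the second order term equal to C^{(2)}, and D₃ is the higher order
remainder. The term with C^{(2)} together with the next term on the right hand side of (2.6) yield the expression
½⟨H₁B′ + 𝐀₁, Δ₁(H₁B′ + 𝐀₁)⟩ = ½⟨H₁B′, Δ₁H₁B′⟩ + ½⟨𝐀₁, Δ₁𝐀₁⟩, (2.7) see the definitions (3.127), (3.128) [13]. Denoting terms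
of at least third order in H₁B′ by V(H₁B′) we get  A(U_k(V′V^{(k)})) = A(U_{k+1}) + ⟨H₁B′, J⟩ + ½⟨H₁B′, Δ₁H₁B′⟩ + V(H₁B′). (2.8)»*
THE TWO FORMULAS OF [15] (p. 284, p. 305, verbatim): *«We are looking for a minimum of the functional  A(U₀) + ⟨A, J⟩ + ½⟨A, Δ_πA⟩
+ V₀(A) (41)»* — the expansion of the Wilson action `A(exp(iηA)U₀)` around the background, i.e. (26) p. 282 of [15] = (3.12)
p. 392 of [13] `A^η(U′U₀) = A^η(U₀) + ⟨A, J⟩ + ½⟨A, ΔA⟩ + …` (with `Δ` replaced by `Δ_π` on the Landau-gauge subspace; [I] (2.6)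
prints `Δ`); *«The configuration 𝓗 is represented as  𝓗 = 𝒜₁ + H₁B − HD(𝒜₁ + H₁B), (174)  where 𝒜₁ satisfies the equation
𝒜₁ + 𝔊((δ/δA′)V)(𝒜₁ + H₁B) = 0, (175)»*, p. 306: *«The function 𝒜₁, as a solution of Eq. (175), is an analytic function of H₁B,
hence of B. … it begins with a term of second order in H₁B … (176)»*; (171) p. 305: *«𝔓*(U_k)J = 0 (171)»*, the rewriting of
(170) *«⟨δA′, J⟩ = 0 for δA′: Q(U_k)δA′ = 0, R(U_k)D^{η*}_{U_k}δA′ = 0»*.  [13] p. 395: *«(3.29) A^η(U^u) = A^η(U)»*,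
*«(R(u)A)(b) = R(u(b₋))A(b) … (3.30)»* — the same `R(u)` as [I] (2.16) p. 269 «B′ → R(u)B′, (R(u)B′)(b) = R(u(b₋))B′(b)».

WHAT THIS FILE DOES (the dictionary; all modelling choices are here).  The gen-4 record `B12ActionExpansion26` proves (2.6)/(2.8)
over ABSTRACT carriers from the named inputs `hA` (gauge invariance), `hrep` (the representation of U_k(V′V^{(k)})), the action
expansion (41) [15], the decomposition (174) [15], (171), «D = C^{(2)} + D₃», the (3.127)–(3.128) identity and (2.7).  HERE the
carrier is the EXACT-BACKGROUND LATTICE of the [13] files: sites `S` (finite), directions `ι` with shifts `T μ : S ≃ S`, the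
background `U₁ = U_{k+1} : ι → S → 𝔸ˣ` (units of a complete normed ℂ-algebra `𝔸`), 𝔸-valued bond fields `ι → S → 𝔸` ∋ 𝐇, a
tracial ℂ-linear functional `τ` (print's `tr`), lattice spacing `η`, dimension `d`:
* the action `A` := `B9Eq31ActionZpow.actionZ T η d τ` (the complexified (3.1) [13] with the printed weight `η^{d−4}`, every `d`);
* the chart `𝐇 ↦ exp iη𝐇 · U_{k+1}` := `B9Eq39Adjoint.prodCfg U₁ η` («U = U′U₀, U′ = exp iηA» [13] p. 390);
* the gauge group `u : S → 𝔸ˣ` acting by (3.28) [13] `B9Eq3117Current.gaugeTr` — packaged as the type synonym `Gauge T 𝔸`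
  with THIS action as its `SMul` instance (§2), so that the abstract record's `[SMul 𝒢 𝒰]` is print's gauge action;
* `⟨·, J_{k+1}⟩` := **`pairJ`** = `𝐇 ↦ B9Eq39Adjoint.bondPair η d τ 𝐇 (J T U₁ η)` ((3.11) [13], a ℂ-linear functional WITH BODY);
* `⟨·, Δ·⟩` := **`hessForm`** = `(A, B) ↦ bondPair η d τ A (B9Eq310Hermitian.deltaOp T U₁ η B)` — THE SYMMETRIC BILINEAR FORM OF
  THE OPERATOR Δ^η(U_{k+1}) of (3.10) [13] (symmetric: `hessForm_symm` = pv27's `bondPair_deltaOp_symm`; its diagonal is the printed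
  quadratic form `hessPair`: `hessForm_self` = `bondPair_deltaOp_self`);
* `V₀` := `B11Eq26ExpansionZpow.V0Z T U₁ η d τ` (r08: (26) [15]'s remainder, = `η^{d−4}Σ_p ρ_p` third order, `V0Z_eq_sum_rem3`,
  `norm_V0Z_le_cubic`).
PROVED (§1): «the gauge invariance of the action» `actionZ_gaugeTr` ((3.29) [13] for the integer-power action; r06's
`action_gaugeTr` is the natural-power twin, the same number for `4 ≤ d`) and **(41) [15] = `expansion41`**: `A(exp iη𝐇 U_{k+1}) = A(U_{k+1}) + ⟨𝐇, J_{k+1}⟩ + ½⟨𝐇, Δ𝐇⟩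
+ V₀(𝐇)` FOR EVERY 𝐇 (r08's `eq26_zpow` + `hessForm_self`) — the two inputs `hA`, `h174`(sic, see ERRATUM) of the record
DISCHARGED.  §3: **`eq26_lattice`** = the record's `B12ActionExpansion26.eq26` APPLIED BY NAME at the lattice instance `latticeData`
of p07's (1.5) record (`H := H₁`, `pairJ := ⟨·, J_{k+1}⟩`, the other fields B12's own p. 267 / §2 objects as parameters — r07's
`B12Eq15DictionaryInstance.dataB9` pattern): (2.6) on the lattice with ONLY the representation `hrep` («U_k(V′V^{(k)}) = [exp
iη𝐇_k(B′)U_{k+1}]^u», [15] Prop. 9 / (172)–(173)) and the decomposition (174) left as named inputs; **`eq26_lattice_at`** = the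
same at ONE field `B′` with print's `B′`-DEPENDENT `𝐀₁ = 𝒜₁(B′)` of (174)–(176) (direct five-line proof).  §4: **`eq28_lattice`** =
the record's `eq28` BY NAME (V = `B12ActionExpansion26.V28` at `β := hessForm`, `V₀ := V0Z`); **`eq28_lattice_at`** = (2.8) at one
field with `𝐀₁ = 𝒜₁(H₁B′)` a FUNCTION of `H₁B′` ([15] p. 306), `D₃ := D − C^{(2)}` BY DEFINITION (the record's `hD` discharged),
and ⟨𝐀₁, J⟩ = 0 DERIVED from (170) [15] (`J_{k+1}` annihilates the constrained subspace `QδA′ = 0, RD*δA′ = 0`) and the membership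
of 𝒜₁ in it — print's «By Eq. (171) [15]»; the V of (2.8) as a function of `w = H₁B′` ALONE: **`Vlat`**.  §4b: **`delta1Form`** =
THE `Δ₁` OF (2.7) WITH BODY at the dictionary — the operator of the (3.127) [13] form «½⟨A, ΔA⟩ − ⟨HC^{(2)}(A), J⟩», `Δ₁(A, B) :=
⟨A, ΔB⟩ − 2⟨H_kC₂(A, B), J_{k+1}⟩` (data `H_k`, `C₂` = polar form of C^{(2)}) — so that the record's input `h3127` («the term with
C^{(2)} together with the next term … yield ½⟨Y, Δ₁Y⟩») holds BY DEFINITION (`h3127_delta1Form`), and **`eq28_lattice_at_delta1Form`**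
= (2.8) with that input discharged too.  §5 (GAPS G-B12-09
(iii), the V₀-part): **(2.16) p. 269 for the dictionary's letters** — `pairJ_gaugeTr` (⟨R(u)𝐇, J[U^u]⟩ = ⟨𝐇, J[U]⟩), `hessForm_gaugeTr`,
`actionZ_prodCfg_gaugeTr`, **`V0Z_gaugeTr`** (`V₀[U^u_{k+1}](R(u)𝐇) = V₀[U_{k+1}](𝐇)`), `expansion41` being termwise invariant;
and **`Vlat_gaugeTr`**: the whole V of (2.8) is invariant GIVEN the (2.16)-covariance of the [15]/[13] data 𝒜₁, H D, H C^{(2)},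
Δ₁ (named hypotheses relating the data at `U_{k+1}` and at `U^u_{k+1}`) — the `V₀`, `⟨·, J⟩`, `⟨·, Δ·⟩` parts being theorems.

ERRATUM FOR THE RECORD `B12ActionExpansion26` (v1.0, p246376, this lineage gen 4; located 2026-08-23 by gen 46, first-hand on [15]
pp. 284/305): its binder LABELS are interchanged relative to [15]'s numbering — the hypothesis named `h174` there («A(chart 𝐇) = A(U₁)
+ ⟨𝐇, J⟩ + ½β(𝐇, 𝐇) + V₀(𝐇)») IS (41) [15] (= (26) [15] = (3.12) [13]) and the hypothesis named `h41` there («𝐇_k(B′) = (H₁B′ + 𝐀₁)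
− H_kD_k(H₁B′ + 𝐀₁)») IS (174) [15]; its module docstring's gloss «(41) the decomposition of the function 𝐇_k … (174) the expansion
of the action» has the two swapped likewise, and its remark «the constant ½⟨𝐀₁, Δ₁𝐀₁⟩ of (2.7) is B′-independent» misreads print
(𝐀₁ = 𝒜₁ of (174)–(175) is a function of H₁B′, second order by (176), so ½⟨𝐀₁, Δ₁𝐀₁⟩ is of fourth order and belongs to V
genuinely).  The MATHEMATICS of the record is unaffected (both hypotheses are used at the point `B′` only; `V28` takes 𝐀₁ as a
parameter, instantiated below at `𝒜₁(H₁B′)`); this file uses the record positionally and names the inputs by their [15] numbers;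
the v1.1 of the record (labels corrected, pointwise forms `eq26_at` ∕ `eq28_at` ∕ `V28fn`, `eq28_at_delta1`, `lagrange_of_eq3128` ∕
`eq28_at_eq3128` added) has landed (p374484).  v1.1 OF THIS FILE (gen 46): §4c `Vlat_eq_V28fn` (`Vlat` = the record's `V28fn` at the
dictionary, `rfl`); §5b `delta1Form_gaugeTr` ((2.16) for `Δ₁` with body, given the polar covariance of `H_kC₂`) and
`Vlat_gaugeTr_delta1Form` (`Vlat_gaugeTr` with its `hΔ₁` hypothesis discharged for `Δ₁ := delta1Form`).

HONEST SCOPE.  (i) DISCHARGED here: gauge invariance of the action and (41) [15] (exact finite-lattice algebra of [13], any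
background of units, no smallness); «D = D^{(2)} + D₃» as the definition of D₃; (171) from (170) + membership.  (ii) KEPT AS NAMED
INPUTS (housed at their rows; `eq28_lattice_at_delta1Form` is the form with the fewest): the representation of U_k(V′V^{(k)}) as a
gauge transform of exp iη𝐇_k(B′)U_{k+1} ([15] Sect. G /
Prop. 9, rows B11.Prop9, B12.Eq2.2-2.3 — the minimiser as a function of B′ is not an object of the tree on this carrier); the
operators H₁ = H_{1,k} ((3.127)/(3.129) [13], row B9.Eq3.127), H = H_k, D = D_k, C^{(2)} and the function 𝒜₁ of (174)–(176) [15]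
(row B11.Eq174; p07's `B11Eq174Chart` types the chart over the abstract contraction scheme, not over this lattice) — all DATA here;
(170) [15] (row B11.Eq170) as the hypothesis `h170` with the two constraint operators `Q`, `RDstar` as data; the Lagrange form of
(3.129) `hlag` for (2.7) (row B9.Eq3.127; in the pointwise forms asked only on the Landau-gauge test fields `RD*a = 0` — the form
print's (3.127)-operator satisfies — and used through `B12Interfaces.quadForm_add_of_orthogonal`; the record's ∀-form goes through
`eq27_of_lagrange`); the (3.127)–(3.128) identity `h3127` UNLESS `Δ₁` is taken with its body `delta1Form` (§4b), where it is
definitional.  (iii) NOT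
HERE: the ORDER claims («D^{(2)} … second order», «at least third order in H₁B′» — only V₀'s third order is a theorem, r08's
`norm_V0Z_le_cubic`), analyticity, (2.9) ff., the torus/one-cover bookkeeping of [I] (the carrier is the [13] files' finite lattice `S` with
commuting shifts where gauge invariance is used).  Located bookkeeping on a published computation; NOT summit progress (not
continuum, not Clay).  No `sorry`, no axiom, no `Prop` fact; definitions WITH BODY: `pairJ`, `hessForm`, `Gauge` (+ its `SMul`, `Gauge.of`),
`latticeData`, `Vlat`, `delta1Form`; axioms standard.
-/

noncomputable section

namespace Literature.MathematicalPhysics.QuantumFieldTheory.Balaban1983to89.B12ActionExpansion26Lattice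

open Literature.MathematicalPhysics.QuantumFieldTheory.Balaban1983to89
open Literature.MathematicalPhysics.QuantumFieldTheory.Balaban1983to89.B9Eq39Adjoint (R R_add R_sub bondPair J prodCfg posPlaq
  plaqU hessPair)
open Literature.MathematicalPhysics.QuantumFieldTheory.Balaban1983to89.B9Eq310Hermitian (deltaOp deltaOp_add_fun deltaOp_smul
  bondPair_deltaOp_symm bondPair_deltaOp_self bondPair_add_left bondPair_add_right)
open Literature.MathematicalPhysics.QuantumFieldTheory.Balaban1983to89.B9Eq3117Current (gaugeTr rotB rotB_apply plaqU_gaugeTr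
  wil_conj prodCfg_gaugeTr bondPair_rotB bondPair_J_gaugeTr deltaOp_gaugeTr bondPair_smul_left)
open Literature.MathematicalPhysics.QuantumFieldTheory.Balaban1983to89.B9Eq31ActionZpow (actionZ)
open Literature.MathematicalPhysics.QuantumFieldTheory.Balaban1983to89.B11Eq26ExpansionZpow (V0Z eq26_zpow)
open Literature.MathematicalPhysics.QuantumFieldTheory.Balaban1983to89.B12Eq15QuadraticForm (Data)
open Literature.MathematicalPhysics.QuantumFieldTheory.Balaban1983to89.B12ActionExpansion26 (V28 V28_apply eq26 eq28)

variable {𝔸 : Type*} [NormedRing 𝔸] [NormedAlgebra ℂ 𝔸] [CompleteSpace 𝔸]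
variable {S : Type*} [Fintype S] {ι : Type*} [Fintype ι] [LinearOrder ι]
variable (T : ι → Equiv.Perm S) (U₁ : ι → S → 𝔸ˣ)

/-! ## §1  The dictionary letters `⟨·, J_{k+1}⟩`, `⟨·, Δ·⟩`, and the two discharged inputs -/

omit [CompleteSpace 𝔸] [LinearOrder ι] in
/-- `⟨A, cE⟩ = c⟨A, E⟩` for the pairing (3.11) [13] (the left twin is r06's `bondPair_smul_left`). [folklore]
[cite: Balaban1985BackgroundPropagators, (3.11) p.392] -/
theorem bondPair_smul_right (η : ℝ) (d : ℕ) (τ : 𝔸 →ₗ[ℂ] ℂ) (c : ℂ) (A E : ι → S → 𝔸) :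
    bondPair η d τ A (c • E) = c * bondPair η d τ A E := by
  simp only [bondPair, Pi.smul_apply, mul_smul_comm, map_smul, smul_eq_mul, Finset.mul_sum]
  refine Finset.sum_congr rfl fun x _ => Finset.sum_congr rfl fun μ _ => ?_
  ring

/-- **`⟨·, J_{k+1}⟩`** — the linear functional `𝐇 ↦ ⟨𝐇, J_{k+1}⟩ = η^d Σ_b tr 𝐇(b)J(b)` of (2.6), with `J = J(U_{k+1}) =
D^{η*}η⁻² Im ∂U_{k+1}` the current (3.11) [13] at the background `U_{k+1}` (`B9Eq39Adjoint.J`), AS A ℂ-LINEAR MAP on the bond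
fields of the fine lattice. [cite: Balaban1987RG1, (2.6) p.266] [cite: Balaban1985BackgroundPropagators, (3.11) p.392] -/
def pairJ (η : ℝ) (d : ℕ) (τ : 𝔸 →ₗ[ℂ] ℂ) : (ι → S → 𝔸) →ₗ[ℂ] ℂ where
  toFun H := bondPair η d τ H (J T U₁ η)
  map_add' A B := bondPair_add_left η d τ A B _
  map_smul' c A := by
    rw [RingHom.id_apply, smul_eq_mul, ← bondPair_smul_left η d τ c A]
    rfl

omit [CompleteSpace 𝔸] in
/-- Unfolding: `pairJ 𝐇 = ⟨𝐇, J(U_{k+1})⟩`. [cite: Balaban1987RG1, (2.6) p.266] -/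
@[simp] theorem pairJ_apply (η : ℝ) (d : ℕ) (τ : 𝔸 →ₗ[ℂ] ℂ) (H : ι → S → 𝔸) :
    pairJ T U₁ η d τ H = bondPair η d τ H (J T U₁ η) := rfl

/-- **`⟨·, Δ·⟩`** — the BILINEAR FORM `(A, B) ↦ ⟨A, Δ^η(U_{k+1})B⟩` of the operator `Δ = D*D_U + Δ′` of (3.10) [13]
(`B9Eq310Hermitian.deltaOp`, pub-balaban pv27) paired by (3.11); the `⟨·, Δ·⟩` of (2.6).  Bilinear by `bondPair_add_left/right`,
`bondPair_smul_left/right`, `deltaOp_add_fun`, `deltaOp_smul`. [cite: Balaban1987RG1, (2.6) p.266]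
[cite: Balaban1985BackgroundPropagators, (3.10) p.392] -/
def hessForm (η : ℝ) (d : ℕ) (τ : 𝔸 →ₗ[ℂ] ℂ) : (ι → S → 𝔸) →ₗ[ℂ] (ι → S → 𝔸) →ₗ[ℂ] ℂ :=
  LinearMap.mk₂ ℂ (fun A B => bondPair η d τ A (deltaOp T U₁ η B))
    (fun A A' B => bondPair_add_left η d τ A A' _)
    (fun c A B => by
      rw [smul_eq_mul, ← bondPair_smul_left η d τ c A]
      rfl)
    (fun A B B' => by
      rw [deltaOp_add_fun, bondPair_add_right])
    (fun c A B => by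
      have h : deltaOp T U₁ η (c • B) = c • deltaOp T U₁ η B := by
        funext μ x
        exact deltaOp_smul T U₁ η c B μ x
      rw [h, bondPair_smul_right, smul_eq_mul])

omit [CompleteSpace 𝔸] in
/-- Unfolding: `hessForm A B = ⟨A, ΔB⟩`. [cite: Balaban1987RG1, (2.6) p.266] [cite: Balaban1985BackgroundPropagators, (3.10) p.392] -/
@[simp] theorem hessForm_apply (η : ℝ) (d : ℕ) (τ : 𝔸 →ₗ[ℂ] ℂ) (A B : ι → S → 𝔸) :
    hessForm T U₁ η d τ A B = bondPair η d τ A (deltaOp T U₁ η B) := rfl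

omit [CompleteSpace 𝔸] in
/-- **`⟨·, Δ·⟩` IS SYMMETRIC** — «it is a hermitian operator» (3.10) [13] (pv27's `bondPair_deltaOp_symm`, exact background of
units, tracial `τ`); the `hsymm` input of the record `B12ActionExpansion26.eq26`. [cite: Balaban1987RG1, (2.6) p.266]
[cite: Balaban1985BackgroundPropagators, (3.10) p.392] -/
theorem hessForm_symm (η : ℝ) (d : ℕ) (τ : 𝔸 →ₗ[ℂ] ℂ) (hτ : ∀ a b : 𝔸, τ (a * b) = τ (b * a))
    (A B : ι → S → 𝔸) : hessForm T U₁ η d τ A B = hessForm T U₁ η d τ B A := by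
  rw [hessForm_apply, hessForm_apply, bondPair_deltaOp_symm T U₁ τ hτ η d B A]

omit [CompleteSpace 𝔸] in
/-- The diagonal of `⟨·, Δ·⟩` is the printed quadratic form `⟨A, ΔA⟩ = ⟨A, D*DA⟩ + ⟨A, Δ′A⟩` of (3.10) [13]
(`B9Eq39Adjoint.hessPair`; pv27's `bondPair_deltaOp_self`). [cite: Balaban1985BackgroundPropagators, (3.10) p.392] -/
theorem hessForm_self (η : ℝ) (d : ℕ) (τ : 𝔸 →ₗ[ℂ] ℂ) (hτ : ∀ a b : 𝔸, τ (a * b) = τ (b * a))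
    (A : ι → S → 𝔸) : hessForm T U₁ η d τ A A = hessPair T U₁ η d τ A := by
  rw [hessForm_apply, bondPair_deltaOp_self T U₁ τ hτ η d A]

omit [CompleteSpace 𝔸] in
/-- **«the gauge invariance of the action»** — (3.29) [13] `A^η(U^u) = A^η(U)` for the integer-power action `actionZ` (every
`d`; r06's `action_gaugeTr` is the natural-power twin): commuting shifts, tracial `τ`, ANY configuration of units, ANY `u`.
[cite: Balaban1987RG1, (2.6) p.266] [cite: Balaban1985BackgroundPropagators, (3.29) p.395] -/
theorem actionZ_gaugeTr (hT : ∀ μ ν x, T μ (T ν x) = T ν (T μ x)) (τ : 𝔸 →ₗ[ℂ] ℂ)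
    (hτ : ∀ a b : 𝔸, τ (a * b) = τ (b * a)) (η : ℝ) (d : ℕ) (u : S → 𝔸ˣ) (U : ι → S → 𝔸ˣ) :
    actionZ T η d τ (gaugeTr T u U) = actionZ T η d τ U := by
  simp only [actionZ, plaqU_gaugeTr T U hT, wil_conj τ hτ]

/-- **(41) [15] DISCHARGED** — the expansion of the action around the background, `A(exp iη𝐇 · U_{k+1}) = A(U_{k+1}) +
⟨𝐇, J_{k+1}⟩ + ½⟨𝐇, Δ𝐇⟩ + V₀(𝐇)` FOR EVERY bond field `𝐇` (the functional of (41) p. 284 = (26) p. 282 of [15] = (3.12) p. 392 of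
[13]; r08's `B11Eq26ExpansionZpow.eq26_zpow` with the quadratic term read through the symmetric form `hessForm`).  This is the
input of `B12ActionExpansion26.eq26` that its v1.0 names `h174` (ERRATUM in the module docstring: it is (41)).
[cite: Balaban1987RG1, (2.6) p.266] [cite: Balaban1985Variational, (41) p.284] [cite: Balaban1985BackgroundPropagators, (3.12) p.392] -/
theorem expansion41 (τ : 𝔸 →ₗ[ℂ] ℂ) (hτ : ∀ a b : 𝔸, τ (a * b) = τ (b * a)) (η : ℝ) (d : ℕ) (H : ι → S → 𝔸) :
    actionZ T η d τ (prodCfg U₁ η H)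
      = actionZ T η d τ U₁ + pairJ T U₁ η d τ H + (1 / 2 : ℂ) * hessForm T U₁ η d τ H H + V0Z T U₁ η d τ H := by
  rw [eq26_zpow T U₁ η d τ H, pairJ_apply, hessForm_self T U₁ η d τ hτ, one_div]

/-! ## §2  The gauge group acting by (3.28) [13] — the record's `[SMul 𝒢 𝒰]` -/

/-- **The gauge group of the lattice**, `u : S → 𝔸ˣ` («u : T → G»), as a type synonym carrying the shifts `T` so that its
action on configurations can be registered as an instance: `u • U := U^u`, `U^u(x, x′) = u(x)U(x, x′)u⁻¹(x′)` ((3.28) [13] =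
`B9Eq3117Current.gaugeTr`; [I] (2.16) «U_{k+1} → U^u_{k+1}»). [cite: Balaban1987RG1, (2.16) p.269]
[cite: Balaban1985BackgroundPropagators, (3.28) p.395] -/
def Gauge (_T : ι → Equiv.Perm S) (𝔸 : Type*) [NormedRing 𝔸] : Type _ := S → 𝔸ˣ

/-- `u • U := U^u` (3.28) [13]. [cite: Balaban1985BackgroundPropagators, (3.28) p.395] -/
instance Gauge.instSMul : SMul (Gauge T 𝔸) (ι → S → 𝔸ˣ) := ⟨fun u U => gaugeTr T u U⟩

/-- A gauge function as an element of `Gauge T 𝔸`. [cite: Balaban1985BackgroundPropagators, (3.28) p.395] -/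
def Gauge.of (u : S → 𝔸ˣ) : Gauge T 𝔸 := u

omit [NormedAlgebra ℂ 𝔸] [CompleteSpace 𝔸] [Fintype S] [Fintype ι] [LinearOrder ι] in
/-- Unfolding: `(Gauge.of u) • U = U^u`. [cite: Balaban1985BackgroundPropagators, (3.28) p.395] -/
@[simp] theorem Gauge.of_smul (u : S → 𝔸ˣ) (U : ι → S → 𝔸ˣ) : (Gauge.of T u : Gauge T 𝔸) • U = gaugeTr T u U := rfl

omit [CompleteSpace 𝔸] in
/-- The record's `hA` on the lattice: `A(g • U) = A(U)` for every `g : Gauge T 𝔸` (= `actionZ_gaugeTr`).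
[cite: Balaban1987RG1, (2.6) p.266] [cite: Balaban1985BackgroundPropagators, (3.29) p.395] -/
theorem actionZ_smul (hT : ∀ μ ν x, T μ (T ν x) = T ν (T μ x)) (τ : 𝔸 →ₗ[ℂ] ℂ)
    (hτ : ∀ a b : 𝔸, τ (a * b) = τ (b * a)) (η : ℝ) (d : ℕ) (g : Gauge T 𝔸) (U : ι → S → 𝔸ˣ) :
    actionZ T η d τ (g • U) = actionZ T η d τ U :=
  actionZ_gaugeTr T hT τ hτ η d g U

/-! ## §3  (2.6) on the lattice — the record `B12ActionExpansion26.eq26` at this dictionary -/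

section TwoSix

variable {V X N : Type*} [AddCommGroup V] [Module ℂ V] [AddCommGroup X] [Module ℂ X] [AddCommGroup N] [Module ℂ N]

/-- **The (1.5) record ON THE LATTICE DICTIONARY**: p07's `B12Eq15QuadraticForm.Data ℂ V (ι → S → 𝔸) X` with `H := H₁ = H_{1,k}`
(the operator (3.127)/(3.129) [13] from the `B′`-fields to the fine-lattice bond fields, DATA), `pairJ := ⟨·, J_{k+1}⟩` (§1, WITH
BODY), and `Δ₁`, `hop`, `C₂`, `G₂` B12's own p. 267 / §2 objects (parameters) — r07's `B12Eq15DictionaryInstance.dataB9` pattern.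
The theorems below are stated for EVERY record `D` whose `pairJ` is `⟨·, J_{k+1}⟩` (`hJ`); `latticeData` is the instance
(`latticeData_pairJ`). [cite: Balaban1987RG1, (1.5) p.261, (2.6) p.266] -/
def latticeData (η : ℝ) (d : ℕ) (τ : 𝔸 →ₗ[ℂ] ℂ) (H₁ : V →ₗ[ℂ] (ι → S → 𝔸))
    (Δ₁ : (ι → S → 𝔸) →ₗ[ℂ] (ι → S → 𝔸) →ₗ[ℂ] ℂ) (hop : X →ₗ[ℂ] V) (C₂ : V →ₗ[ℂ] V →ₗ[ℂ] X)
    (G₂ : V →ₗ[ℂ] V →ₗ[ℂ] ℂ) : Data ℂ V (ι → S → 𝔸) X where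
  H := H₁
  Δ₁ := Δ₁
  hop := hop
  C₂ := C₂
  pairJ := pairJ T U₁ η d τ
  G₂ := G₂

variable (η : ℝ) (d : ℕ) (τ : 𝔸 →ₗ[ℂ] ℂ)

section Instance

variable (H₁ : V →ₗ[ℂ] (ι → S → 𝔸)) (Δ₁ : (ι → S → 𝔸) →ₗ[ℂ] (ι → S → 𝔸) →ₗ[ℂ] ℂ) (hop : X →ₗ[ℂ] V)
  (C₂ : V →ₗ[ℂ] V →ₗ[ℂ] X) (G₂ : V →ₗ[ℂ] V →ₗ[ℂ] ℂ)

omit [CompleteSpace 𝔸] in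
/-- `(latticeData …).H = H₁`. [cite: Balaban1987RG1, (1.5) p.261] -/
@[simp] theorem latticeData_H : (latticeData T U₁ η d τ H₁ Δ₁ hop C₂ G₂).H = H₁ := rfl

omit [CompleteSpace 𝔸] in
/-- `(latticeData …).pairJ = ⟨·, J_{k+1}⟩` — the instance satisfies the hypothesis `hJ` of the theorems below.
[cite: Balaban1987RG1, (1.5) p.261, (2.6) p.266] -/
@[simp] theorem latticeData_pairJ : (latticeData T U₁ η d τ H₁ Δ₁ hop C₂ G₂).pairJ = pairJ T U₁ η d τ := rfl

omit [CompleteSpace 𝔸] in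
/-- `(latticeData …).Δ₁ = Δ₁`. [cite: Balaban1987RG1, (1.5) p.261] -/
@[simp] theorem latticeData_Δ₁ : (latticeData T U₁ η d τ H₁ Δ₁ hop C₂ G₂).Δ₁ = Δ₁ := rfl

end Instance

/-- **(2.6) ON THE EXACT-BACKGROUND LATTICE** — the record `B12ActionExpansion26.eq26` APPLIED BY NAME with «the gauge invariance of
the action» := `actionZ_smul` and (41) [15] := `expansion41` (both DISCHARGED, §§1–2), `⟨·, Δ·⟩ := hessForm` (symmetric,
`hessForm_symm`), `V₀ := V0Z`, for every (1.5) record `D` on the lattice with `D.pairJ = ⟨·, J_{k+1}⟩` (`hJ`; `H₁ = D.H`): for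
`rep B′ = U_k(V′V^{(k)})` represented on `Dom` as a gauge transform of `exp iη𝐇_k(B′)U_{k+1}` (`hrep`, [15] Prop. 9 / (172)–(173) —
NAMED INPUT) and `𝐇_k(B′) = (H₁B′ + 𝐀₁) − H_kD_k(H₁B′ + 𝐀₁)` ((174) [15] — NAMED INPUT, the record's ∀-form with `𝐀₁` a fixed
vector; the `B′`-dependent 𝒜₁ of (175)–(176) is `eq26_lattice_at`):
`A(U_k(V′V^{(k)})) = A(U_{k+1}) + ⟨Y, J_{k+1}⟩ − ⟨H_kD_k(Y), J_{k+1}⟩ + ½⟨Y, ΔY⟩ − ⟨Y, ΔH_kD_k(Y)⟩ + ½⟨H_kD_k(Y), ΔH_kD_k(Y)⟩ +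
V₀(Y − H_kD_k(Y))`, `Y = H₁B′ + 𝐀₁`. [cite: Balaban1987RG1, (2.6) p.266] [cite: Balaban1985Variational, (41) p.284, (174) p.305] -/
theorem eq26_lattice (hT : ∀ μ ν x, T μ (T ν x) = T ν (T μ x)) (hτ : ∀ a b : 𝔸, τ (a * b) = τ (b * a))
    (D : Data ℂ V (ι → S → 𝔸) X) (hJ : D.pairJ = pairJ T U₁ η d τ)
    {rep : V → (ι → S → 𝔸ˣ)} {Hfn : V → (ι → S → 𝔸)} {Dom : Set V}
    (hrep : ∀ B ∈ Dom, ∃ u : S → 𝔸ˣ, rep B = gaugeTr T u (prodCfg U₁ η (Hfn B)))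
    {A₁ : ι → S → 𝔸} {Hk : N →ₗ[ℂ] (ι → S → 𝔸)} {Dk : (ι → S → 𝔸) → N}
    (h174 : ∀ B : V, Hfn B = (D.H B + A₁) - Hk (Dk (D.H B + A₁))) {B' : V} (hB : B' ∈ Dom) :
    actionZ T η d τ (rep B')
      = actionZ T η d τ U₁ + pairJ T U₁ η d τ (D.H B' + A₁) - pairJ T U₁ η d τ (Hk (Dk (D.H B' + A₁)))
        + (1 / 2 : ℂ) * hessForm T U₁ η d τ (D.H B' + A₁) (D.H B' + A₁)
        - hessForm T U₁ η d τ (D.H B' + A₁) (Hk (Dk (D.H B' + A₁)))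
        + (1 / 2 : ℂ) * hessForm T U₁ η d τ (Hk (Dk (D.H B' + A₁))) (Hk (Dk (D.H B' + A₁)))
        + V0Z T U₁ η d τ ((D.H B' + A₁) - Hk (Dk (D.H B' + A₁))) := by
  have h := eq26 (𝒢 := Gauge T 𝔸) D (A := actionZ T η d τ) (fun g U => actionZ_smul T hT τ hτ η d g U)
    (rep := rep) (chart := prodCfg U₁ η) (Hfn := Hfn) (Dom := Dom)
    (fun B hBD => by
      obtain ⟨u, hu⟩ := hrep B hBD
      exact ⟨Gauge.of T u, hu⟩)
    (U₁ := U₁) (β := hessForm T U₁ η d τ) (hessForm_symm T U₁ η d τ hτ) (V₀ := V0Z T U₁ η d τ) (DomH := Set.univ)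
    (fun H _ => by
      rw [hJ]
      exact expansion41 T U₁ τ hτ η d H)
    (A₁ := A₁) (Hk := Hk) (Dk := Dk) h174 hB (Set.mem_univ _)
  rw [hJ] at h
  exact h

/-- **(2.6) AT ONE FIELD, WITH PRINT'S `B′`-DEPENDENT 𝐀₁** ([15] (174)–(176): «𝒜₁ … is an analytic function of H₁B, hence of B …
begins with a term of second order in H₁B»): with `w = H₁B′` and `𝒜₁ = 𝒜₁(B′)` ANY vectors, if `U_k(V′V^{(k)}) =
[exp iη𝐇_k(B′)U_{k+1}]^u` (the representation, [15] Sect. G / Prop. 9 — NAMED INPUT) and `𝐇_k(B′) = (w + 𝒜₁) − H_kD_k(w + 𝒜₁)`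
((174) at this `B′` — NAMED INPUT), then the last member of (2.6) holds — by «the gauge invariance of the action» (`actionZ_gaugeTr`)
and (41) [15] (`expansion41`), both theorems here, and the bilinearity/symmetry of `⟨·, Δ·⟩`. [cite: Balaban1987RG1, (2.6) p.266]
[cite: Balaban1985Variational, (41) p.284, (174) p.305] -/
theorem eq26_lattice_at (hT : ∀ μ ν x, T μ (T ν x) = T ν (T μ x)) (hτ : ∀ a b : 𝔸, τ (a * b) = τ (b * a))
    {repB : ι → S → 𝔸ˣ} {HfnB : ι → S → 𝔸}
    (hrep : ∃ u : S → 𝔸ˣ, repB = gaugeTr T u (prodCfg U₁ η HfnB))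
    {w 𝒜₁ : ι → S → 𝔸} {Hk : N →ₗ[ℂ] (ι → S → 𝔸)} {Dk : (ι → S → 𝔸) → N}
    (h174 : HfnB = (w + 𝒜₁) - Hk (Dk (w + 𝒜₁))) :
    actionZ T η d τ repB
      = actionZ T η d τ U₁ + pairJ T U₁ η d τ (w + 𝒜₁) - pairJ T U₁ η d τ (Hk (Dk (w + 𝒜₁)))
        + (1 / 2 : ℂ) * hessForm T U₁ η d τ (w + 𝒜₁) (w + 𝒜₁)
        - hessForm T U₁ η d τ (w + 𝒜₁) (Hk (Dk (w + 𝒜₁)))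
        + (1 / 2 : ℂ) * hessForm T U₁ η d τ (Hk (Dk (w + 𝒜₁))) (Hk (Dk (w + 𝒜₁)))
        + V0Z T U₁ η d τ ((w + 𝒜₁) - Hk (Dk (w + 𝒜₁))) := by
  obtain ⟨u, hu⟩ := hrep
  have hexp := expansion41 T U₁ τ hτ η d HfnB
  rw [hu, actionZ_gaugeTr T hT τ hτ, hexp, h174]
  have h2 : hessForm T U₁ η d τ (Hk (Dk (w + 𝒜₁))) (w + 𝒜₁) = hessForm T U₁ η d τ (w + 𝒜₁) (Hk (Dk (w + 𝒜₁))) :=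
    hessForm_symm T U₁ η d τ hτ _ _
  simp only [map_sub, LinearMap.sub_apply, h2]
  ring

end TwoSix

/-! ## §4  (2.8) on the lattice — the record `B12ActionExpansion26.eq28` / `V28` at this dictionary -/

section TwoEight

variable {V X N N' : Type*} [AddCommGroup V] [Module ℂ V] [AddCommGroup X] [Module ℂ X] [AddCommGroup N] [Module ℂ N]
  [AddCommGroup N'] [Module ℂ N']

variable (η : ℝ) (d : ℕ) (τ : 𝔸 →ₗ[ℂ] ℂ)

/-- **(2.8) ON THE EXACT-BACKGROUND LATTICE** — the record `B12ActionExpansion26.eq28` APPLIED BY NAME at a lattice record `D`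
(`D.pairJ = ⟨·, J_{k+1}⟩`, `H₁ = D.H`, `Δ₁ = D.Δ₁`), `⟨·, Δ·⟩ := hessForm`, `V₀ := V0Z` (gauge invariance and (41) [15] DISCHARGED):
`A(U_k(V′V^{(k)})) = A(U_{k+1}) + ⟨H₁B′, J⟩ + ½⟨H₁B′, Δ₁H₁B′⟩ + V(H₁B′)` with `V = B12ActionExpansion26.V28` (the terms of (2.6)
not displayed in (2.8), explicit).  NAMED INPUTS, as in the record: `hrep` (representation), `h174` ((174) [15], ∀-form, 𝐀₁ a
fixed vector), `h171` (⟨𝐀₁, J⟩ = 0, (171) [15]), `hD` (D = C^{(2)} + D₃), `h3127` («the term with C^{(2)} together with the next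
term … yield ½⟨Y, Δ₁Y⟩», (3.127)–(3.128) [13]), and for (2.7) (`B12Interfaces.eq27_of_lagrange`) `hsymm₁`, `hlag` (the Lagrange
form of (3.129) [13]: Δ₁H₁B′ = Q*ω), `hQA₁` (Q𝐀₁ = 0). [cite: Balaban1987RG1, (2.8) p.266]
[cite: Balaban1985Variational, (41) p.284, (171) p.305, (174) p.305] [cite: Balaban1985BackgroundPropagators, (3.127)-(3.128) p.421] -/
theorem eq28_lattice (hT : ∀ μ ν x, T μ (T ν x) = T ν (T μ x)) (hτ : ∀ a b : 𝔸, τ (a * b) = τ (b * a))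
    (D : Data ℂ V (ι → S → 𝔸) X) (hJ : D.pairJ = pairJ T U₁ η d τ)
    {rep : V → (ι → S → 𝔸ˣ)} {Hfn : V → (ι → S → 𝔸)} {Dom : Set V}
    (hrep : ∀ B ∈ Dom, ∃ u : S → 𝔸ˣ, rep B = gaugeTr T u (prodCfg U₁ η (Hfn B)))
    {A₁ : ι → S → 𝔸} {Hk : N →ₗ[ℂ] (ι → S → 𝔸)} {Dk : (ι → S → 𝔸) → N}
    (h174 : ∀ B : V, Hfn B = (D.H B + A₁) - Hk (Dk (D.H B + A₁)))
    (h171 : pairJ T U₁ η d τ A₁ = 0) {C2 D3 : (ι → S → 𝔸) → N} (hD : ∀ Y, Dk Y = C2 Y + D3 Y)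
    (h3127 : ∀ Y, -pairJ T U₁ η d τ (Hk (C2 Y)) + (1 / 2 : ℂ) * hessForm T U₁ η d τ Y Y = (1 / 2 : ℂ) * D.Δ₁ Y Y)
    (hsymm₁ : ∀ x y, D.Δ₁ x y = D.Δ₁ y x) (Q : (ι → S → 𝔸) →ₗ[ℂ] N') (pair : N' →ₗ[ℂ] N' →ₗ[ℂ] ℂ) (ω : N') {B' : V}
    (hlag : ∀ a, D.Δ₁ a (D.H B') = pair (Q a) ω) (hQA₁ : Q A₁ = 0) (hB : B' ∈ Dom) :
    actionZ T η d τ (rep B')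
      = actionZ T η d τ U₁ + pairJ T U₁ η d τ (D.H B') + (1 / 2 : ℂ) * D.Δ₁ (D.H B') (D.H B')
        + V28 D (hessForm T U₁ η d τ) (V0Z T U₁ η d τ) A₁ Hk Dk D3 (D.H B') := by
  have h171' : D.pairJ A₁ = 0 := by rw [hJ]; exact h171
  have h3127' : ∀ Y, -D.pairJ (Hk (C2 Y)) + (1 / 2 : ℂ) * hessForm T U₁ η d τ Y Y = (1 / 2 : ℂ) * D.Δ₁ Y Y := by
    rw [hJ]; exact h3127
  have h := eq28 (𝒢 := Gauge T 𝔸) D (A := actionZ T η d τ) (fun g U => actionZ_smul T hT τ hτ η d g U)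
    (rep := rep) (chart := prodCfg U₁ η) (Hfn := Hfn) (Dom := Dom)
    (fun B hBD => by
      obtain ⟨u, hu⟩ := hrep B hBD
      exact ⟨Gauge.of T u, hu⟩)
    (U₁ := U₁) (β := hessForm T U₁ η d τ) (hessForm_symm T U₁ η d τ hτ) (V₀ := V0Z T U₁ η d τ) (DomH := Set.univ)
    (fun H _ => by
      rw [hJ]
      exact expansion41 T U₁ τ hτ η d H)
    (A₁ := A₁) (Hk := Hk) (Dk := Dk) h174 h171' hD h3127' hsymm₁ Q pair ω hlag hQA₁ hB (Set.mem_univ _)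
  rw [hJ] at h
  exact h

/-- **The V of (2.8) as a function of `w = H₁B′` ALONE** («Denoting terms of at least third order in H₁B′ by V(H₁B′)»), on the
lattice dictionary: the record's `V28` at `⟨·, Δ·⟩ := hessForm`, `V₀ := V0Z`, with print's `𝐀₁ = 𝒜₁(w)` A FUNCTION OF `w = H₁B′`
([15] p. 306) and `D₃ := D − C^{(2)}` («we decompose the function D into the sum D^{(2)} + D₃»):
`V(w) = ½⟨𝒜₁(w), Δ₁𝒜₁(w)⟩ − ⟨H(D − C^{(2)})(Y), J⟩ − ⟨Y, ΔHD(Y)⟩ + ½⟨HD(Y), ΔHD(Y)⟩ + V₀(Y − HD(Y))`, `Y = w + 𝒜₁(w)`.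
[cite: Balaban1987RG1, (2.8) p.266] [cite: Balaban1985Variational, (174)-(176) p.305-306] -/
def Vlat (D : Data ℂ V (ι → S → 𝔸) X) (𝒜 : (ι → S → 𝔸) → (ι → S → 𝔸)) (Hk : N →ₗ[ℂ] (ι → S → 𝔸))
    (Dk C2 : (ι → S → 𝔸) → N) (w : ι → S → 𝔸) : ℂ :=
  V28 D (hessForm T U₁ η d τ) (V0Z T U₁ η d τ) (𝒜 w) Hk Dk (fun Y => Dk Y - C2 Y) w

/-- Unfolding of `Vlat` into the five printed terms. [cite: Balaban1987RG1, (2.8) p.266] -/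
theorem Vlat_apply (D : Data ℂ V (ι → S → 𝔸) X) (𝒜 : (ι → S → 𝔸) → (ι → S → 𝔸)) (Hk : N →ₗ[ℂ] (ι → S → 𝔸))
    (Dk C2 : (ι → S → 𝔸) → N) (w : ι → S → 𝔸) :
    Vlat T U₁ η d τ D 𝒜 Hk Dk C2 w
      = (1 / 2 : ℂ) * D.Δ₁ (𝒜 w) (𝒜 w) - D.pairJ (Hk (Dk (w + 𝒜 w) - C2 (w + 𝒜 w)))
        - hessForm T U₁ η d τ (w + 𝒜 w) (Hk (Dk (w + 𝒜 w)))
        + (1 / 2 : ℂ) * hessForm T U₁ η d τ (Hk (Dk (w + 𝒜 w))) (Hk (Dk (w + 𝒜 w)))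
        + V0Z T U₁ η d τ ((w + 𝒜 w) - Hk (Dk (w + 𝒜 w))) := by
  rw [Vlat, V28_apply]

/-- **(2.8) AT ONE FIELD `B′`, PRINT'S READING IN FULL** (for a lattice record `D`, `D.pairJ = ⟨·, J_{k+1}⟩`, `H₁ = D.H`, `Δ₁ =
D.Δ₁`): 𝐀₁ = 𝒜₁(H₁B′) a function of H₁B′ ((174)–(176) [15]); «By Eq. (171) [15] we have ⟨𝐀₁, J⟩ = 0» DERIVED from (170) [15] —
`J_{k+1}` annihilates every `δA′` with `QδA′ = 0`, `RD*δA′ = 0` (`h170`, the two constraint operators `Q`, `RDstar` DATA) — and the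
membership of 𝒜₁ in that subspace (`hQ𝒜`, `hR𝒜`: (175) + the regularity/gauge conditions (19)–(21) of [15]); «D = D^{(2)} + D₃ …
D^{(2)} … equal to C^{(2)}» with `D₃ := D − C^{(2)}` BY DEFINITION; «the term with C^{(2)} together with the next term … yield
½⟨Y, Δ₁Y⟩ … (3.127), (3.128) [13]» (`h3127`, NAMED); (2.7) by `B12Interfaces.quadForm_add_of_orthogonal` (Seam 2) from the Lagrange
form of (3.129) [13] ON THE LANDAU-GAUGE TEST FIELDS — `hlag : RD*a = 0 → Δ₁(a, H₁B′) = ⟨Qa, ω⟩` (NAMED; the unrestricted ∀a-form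
would be false for the (3.127) form, which is gauge-invariantly extended only in (3.128)) — and the membership `Q𝒜₁ = 0`, `RD*𝒜₁ = 0`;
gauge invariance and (41) [15] THEOREMS (§1).  Conclusion: `A(U_k(V′V^{(k)})) = A(U_{k+1}) + ⟨H₁B′, J⟩ + ½⟨H₁B′, Δ₁H₁B′⟩ + V(H₁B′)`,
`V = Vlat`. [cite: Balaban1987RG1, (2.7) p.266, (2.8) p.266]
[cite: Balaban1985Variational, (170)-(171) p.305, (174) p.305] [cite: Balaban1985BackgroundPropagators, (3.127)-(3.129) p.421] -/
theorem eq28_lattice_at (hT : ∀ μ ν x, T μ (T ν x) = T ν (T μ x)) (hτ : ∀ a b : 𝔸, τ (a * b) = τ (b * a))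
    (D : Data ℂ V (ι → S → 𝔸) X) (hJ : D.pairJ = pairJ T U₁ η d τ)
    {repB : ι → S → 𝔸ˣ} {HfnB : ι → S → 𝔸}
    (hrep : ∃ u : S → 𝔸ˣ, repB = gaugeTr T u (prodCfg U₁ η HfnB))
    {𝒜 : (ι → S → 𝔸) → (ι → S → 𝔸)} {Hk : N →ₗ[ℂ] (ι → S → 𝔸)} {Dk C2 : (ι → S → 𝔸) → N} {B' : V}
    (h174 : HfnB = (D.H B' + 𝒜 (D.H B')) - Hk (Dk (D.H B' + 𝒜 (D.H B'))))
    {Q : (ι → S → 𝔸) →ₗ[ℂ] N'} {RDstar : (ι → S → 𝔸) →ₗ[ℂ] N}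
    (h170 : ∀ a : ι → S → 𝔸, Q a = 0 → RDstar a = 0 → pairJ T U₁ η d τ a = 0)
    (hQ𝒜 : Q (𝒜 (D.H B')) = 0) (hR𝒜 : RDstar (𝒜 (D.H B')) = 0)
    (h3127 : ∀ Y, -pairJ T U₁ η d τ (Hk (C2 Y)) + (1 / 2 : ℂ) * hessForm T U₁ η d τ Y Y = (1 / 2 : ℂ) * D.Δ₁ Y Y)
    (hsymm₁ : ∀ x y, D.Δ₁ x y = D.Δ₁ y x) (pair : N' →ₗ[ℂ] N' →ₗ[ℂ] ℂ) (ω : N')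
    (hlag : ∀ a, RDstar a = 0 → D.Δ₁ a (D.H B') = pair (Q a) ω) :
    actionZ T η d τ repB
      = actionZ T η d τ U₁ + pairJ T U₁ η d τ (D.H B') + (1 / 2 : ℂ) * D.Δ₁ (D.H B') (D.H B')
        + Vlat T U₁ η d τ D 𝒜 Hk Dk C2 (D.H B') := by
  -- (171) [15] for 𝐀₁ = 𝒜₁(H₁B′), from (170) and membership
  have h171 : pairJ T U₁ η d τ (𝒜 (D.H B')) = 0 := h170 _ hQ𝒜 hR𝒜
  rw [eq26_lattice_at T U₁ η d τ hT hτ hrep h174, Vlat_apply, hJ]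
  -- (2.7) at h = H₁B′, a = 𝒜₁(H₁B′): Pythagoras for the Landau-gauge, zero-average directions (`B12Interfaces`, Seam 2)
  have h27 : D.Δ₁ (D.H B' + 𝒜 (D.H B')) (D.H B' + 𝒜 (D.H B'))
      = D.Δ₁ (D.H B') (D.H B') + D.Δ₁ (𝒜 (D.H B')) (𝒜 (D.H B')) :=
    B12Interfaces.quadForm_add_of_orthogonal D.Δ₁ hsymm₁ (LinearMap.ker Q ⊓ LinearMap.ker RDstar) (D.H B')
      (fun a ha => by
        rw [Submodule.mem_inf, LinearMap.mem_ker, LinearMap.mem_ker] at ha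
        rw [hlag a ha.2, ha.1, map_zero, LinearMap.zero_apply])
      (Submodule.mem_inf.mpr ⟨LinearMap.mem_ker.mpr hQ𝒜, LinearMap.mem_ker.mpr hR𝒜⟩)
  -- «the term with C⁽²⁾ together with the next term» at Y = H₁B′ + 𝒜₁
  have hC := h3127 (D.H B' + 𝒜 (D.H B'))
  have hJadd : pairJ T U₁ η d τ (D.H B' + 𝒜 (D.H B')) = pairJ T U₁ η d τ (D.H B') := by
    rw [map_add, h171, add_zero]
  have hDJ : pairJ T U₁ η d τ (Hk (Dk (D.H B' + 𝒜 (D.H B'))))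
      = pairJ T U₁ η d τ (Hk (C2 (D.H B' + 𝒜 (D.H B'))))
        + pairJ T U₁ η d τ (Hk (Dk (D.H B' + 𝒜 (D.H B')) - C2 (D.H B' + 𝒜 (D.H B')))) := by
    rw [← map_add, ← map_add, add_sub_cancel]
  rw [hJadd, hDJ]
  linear_combination hC + (1 / 2 : ℂ) * h27


/-! ### §4b  The `Δ₁` of (2.7) WITH BODY at the dictionary: the operator of the (3.127) [13] form -/

/-- **`Δ₁` OF (2.7)–(2.8) WITH BODY** — «The term with C^{(2)} together with the next term on the right hand side of (2.6) yield
the expression ½⟨H₁B′ + 𝐀₁, Δ₁(H₁B′ + 𝐀₁)⟩ … see the definitions (3.127), (3.128) [13]»: `Δ₁` is the operator of the quadratic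
form (3.127) [13] «½⟨A, ΔA⟩ − ⟨HC^{(2)}(A), J⟩» (the form replacing (3.109) in the variational problem defining H₁), i.e. the
BILINEAR FORM `Δ₁(A, B) := ⟨A, ΔB⟩ − 2⟨H_kC₂(A, B), J_{k+1}⟩` with `C₂` the polar form of [15]'s second-order term `C^{(2)}`
(`C^{(2)}(Y) = C₂(Y, Y)`) and `H_k` the [15] operator — DATA `Hk`, `C₂`; `⟨·, Δ·⟩ = hessForm`, `⟨·, J_{k+1}⟩ = pairJ` the
dictionary's letters. [cite: Balaban1987RG1, (2.7) p.266] [cite: Balaban1985BackgroundPropagators, (3.127) p.421] -/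
def delta1Form (Hk : N →ₗ[ℂ] (ι → S → 𝔸)) (C₂ : (ι → S → 𝔸) →ₗ[ℂ] (ι → S → 𝔸) →ₗ[ℂ] N) :
    (ι → S → 𝔸) →ₗ[ℂ] (ι → S → 𝔸) →ₗ[ℂ] ℂ :=
  hessForm T U₁ η d τ - (2 : ℂ) • C₂.compr₂ (pairJ T U₁ η d τ ∘ₗ Hk)

omit [CompleteSpace 𝔸] in
/-- Unfolding: `Δ₁(A, B) = ⟨A, ΔB⟩ − 2⟨H_kC₂(A, B), J_{k+1}⟩`. [cite: Balaban1987RG1, (2.7) p.266]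
[cite: Balaban1985BackgroundPropagators, (3.127) p.421] -/
theorem delta1Form_apply (Hk : N →ₗ[ℂ] (ι → S → 𝔸)) (C₂ : (ι → S → 𝔸) →ₗ[ℂ] (ι → S → 𝔸) →ₗ[ℂ] N)
    (A B : ι → S → 𝔸) :
    delta1Form T U₁ η d τ Hk C₂ A B = hessForm T U₁ η d τ A B - 2 * pairJ T U₁ η d τ (Hk (C₂ A B)) := by
  simp [delta1Form]

omit [CompleteSpace 𝔸] in
/-- `Δ₁` is symmetric when `C₂` is (and `⟨·, Δ·⟩` is, `hessForm_symm`). [cite: Balaban1987RG1, (2.7) p.266]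
[cite: Balaban1985BackgroundPropagators, (3.127) p.421] -/
theorem delta1Form_symm (hτ : ∀ a b : 𝔸, τ (a * b) = τ (b * a)) (Hk : N →ₗ[ℂ] (ι → S → 𝔸))
    (C₂ : (ι → S → 𝔸) →ₗ[ℂ] (ι → S → 𝔸) →ₗ[ℂ] N) (hC : ∀ x y, C₂ x y = C₂ y x) (A B : ι → S → 𝔸) :
    delta1Form T U₁ η d τ Hk C₂ A B = delta1Form T U₁ η d τ Hk C₂ B A := by
  rw [delta1Form_apply, delta1Form_apply, hessForm_symm T U₁ η d τ hτ, hC]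

omit [CompleteSpace 𝔸] in
/-- **THE (3.127) SENTENCE DISCHARGED BY DEFINITION**: «the term with C^{(2)} together with the next term … yield ½⟨Y, Δ₁Y⟩» —
`−⟨H_kC^{(2)}(Y), J⟩ + ½⟨Y, ΔY⟩ = ½Δ₁(Y, Y)` for `C^{(2)}(Y) = C₂(Y, Y)`; this is the input `h3127` of `eq28` / `eq28_lattice_at`
at `Δ₁ := delta1Form`. [cite: Balaban1987RG1, (2.7) p.266] [cite: Balaban1985BackgroundPropagators, (3.127) p.421] -/
theorem h3127_delta1Form (Hk : N →ₗ[ℂ] (ι → S → 𝔸)) (C₂ : (ι → S → 𝔸) →ₗ[ℂ] (ι → S → 𝔸) →ₗ[ℂ] N)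
    (Y : ι → S → 𝔸) :
    -pairJ T U₁ η d τ (Hk (C₂ Y Y)) + (1 / 2 : ℂ) * hessForm T U₁ η d τ Y Y
      = (1 / 2 : ℂ) * delta1Form T U₁ η d τ Hk C₂ Y Y := by
  rw [delta1Form_apply]
  ring

/-- **(2.8) AT ONE FIELD WITH `Δ₁` WITH BODY**: `eq28_lattice_at` at a lattice record whose `Δ₁` IS `delta1Form Hk C₂` (`hΔ`) and
`C^{(2)}(Y) = C₂(Y, Y)` — the (3.127)–(3.128) input DISCHARGED (`h3127_delta1Form`), `Δ₁` symmetric from `C₂` symmetric; remaining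
NAMED INPUTS: the representation (`hrep`), (174) with its data (`h174`), (170) + membership (`h170`, `hQ𝒜`, `hR𝒜`), and the
Lagrange form of (3.129) [13] for this `Δ₁` on the Landau-gauge test fields (`hlag`: for `RD*a = 0`, `Δ₁(a, H₁B′) = ⟨a, G₁⁻¹H₁B′⟩ −
a⟨Qa, QH₁B′⟩ = ⟨Qa, ω′⟩ by (3.128)–(3.129) — NAMED, row B9.Eq3.127). [cite: Balaban1987RG1, (2.7) p.266, (2.8) p.266]
[cite: Balaban1985Variational, (170)-(171) p.305, (174) p.305] [cite: Balaban1985BackgroundPropagators, (3.127)-(3.129) p.421] -/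
theorem eq28_lattice_at_delta1Form (hT : ∀ μ ν x, T μ (T ν x) = T ν (T μ x))
    (hτ : ∀ a b : 𝔸, τ (a * b) = τ (b * a)) (D : Data ℂ V (ι → S → 𝔸) X) (hJ : D.pairJ = pairJ T U₁ η d τ)
    {Hk : N →ₗ[ℂ] (ι → S → 𝔸)} {C₂ : (ι → S → 𝔸) →ₗ[ℂ] (ι → S → 𝔸) →ₗ[ℂ] N} (hC : ∀ x y, C₂ x y = C₂ y x)
    (hΔ : D.Δ₁ = delta1Form T U₁ η d τ Hk C₂)
    {repB : ι → S → 𝔸ˣ} {HfnB : ι → S → 𝔸}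
    (hrep : ∃ u : S → 𝔸ˣ, repB = gaugeTr T u (prodCfg U₁ η HfnB))
    {𝒜 : (ι → S → 𝔸) → (ι → S → 𝔸)} {Dk : (ι → S → 𝔸) → N} {B' : V}
    (h174 : HfnB = (D.H B' + 𝒜 (D.H B')) - Hk (Dk (D.H B' + 𝒜 (D.H B'))))
    {Q : (ι → S → 𝔸) →ₗ[ℂ] N'} {RDstar : (ι → S → 𝔸) →ₗ[ℂ] N}
    (h170 : ∀ a : ι → S → 𝔸, Q a = 0 → RDstar a = 0 → pairJ T U₁ η d τ a = 0)
    (hQ𝒜 : Q (𝒜 (D.H B')) = 0) (hR𝒜 : RDstar (𝒜 (D.H B')) = 0) (pair : N' →ₗ[ℂ] N' →ₗ[ℂ] ℂ) (ω : N')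
    (hlag : ∀ a, RDstar a = 0 → D.Δ₁ a (D.H B') = pair (Q a) ω) :
    actionZ T η d τ repB
      = actionZ T η d τ U₁ + pairJ T U₁ η d τ (D.H B') + (1 / 2 : ℂ) * D.Δ₁ (D.H B') (D.H B')
        + Vlat T U₁ η d τ D 𝒜 Hk Dk (fun Y => C₂ Y Y) (D.H B') :=
  eq28_lattice_at T U₁ η d τ hT hτ D hJ hrep h174 h170 hQ𝒜 hR𝒜
    (fun Y => by rw [hΔ]; exact h3127_delta1Form T U₁ η d τ Hk C₂ Y)
    (fun x y => by rw [hΔ]; exact delta1Form_symm T U₁ η d τ hτ Hk C₂ hC x y) pair ω hlag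

/-- On the instance: `Vlat (latticeData …)` reads with `H₁`, `Δ₁` and `⟨·, J_{k+1}⟩` literally — nothing but the dictionary's
letters and the [15] data `𝒜₁`, `H`, `D`, `C^{(2)}`. [cite: Balaban1987RG1, (2.8) p.266] -/
theorem Vlat_latticeData (H₁ : V →ₗ[ℂ] (ι → S → 𝔸)) (Δ₁ : (ι → S → 𝔸) →ₗ[ℂ] (ι → S → 𝔸) →ₗ[ℂ] ℂ)
    (hop : X →ₗ[ℂ] V) (C₂ : V →ₗ[ℂ] V →ₗ[ℂ] X) (G₂ : V →ₗ[ℂ] V →ₗ[ℂ] ℂ)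
    (𝒜 : (ι → S → 𝔸) → (ι → S → 𝔸)) (Hk : N →ₗ[ℂ] (ι → S → 𝔸)) (Dk C2 : (ι → S → 𝔸) → N) (w : ι → S → 𝔸) :
    Vlat T U₁ η d τ (latticeData T U₁ η d τ H₁ Δ₁ hop C₂ G₂) 𝒜 Hk Dk C2 w
      = (1 / 2 : ℂ) * Δ₁ (𝒜 w) (𝒜 w) - pairJ T U₁ η d τ (Hk (Dk (w + 𝒜 w) - C2 (w + 𝒜 w)))
        - hessForm T U₁ η d τ (w + 𝒜 w) (Hk (Dk (w + 𝒜 w)))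
        + (1 / 2 : ℂ) * hessForm T U₁ η d τ (Hk (Dk (w + 𝒜 w))) (Hk (Dk (w + 𝒜 w)))
        + V0Z T U₁ η d τ ((w + 𝒜 w) - Hk (Dk (w + 𝒜 w))) := by
  rw [Vlat_apply]
  rfl

end TwoEight

/-! ## §5  (2.16) for the dictionary's letters — GAPS G-B12-09 (iii), the `V₀`-part -/

section GaugeInvariance

variable (η : ℝ) (d : ℕ) (τ : 𝔸 →ₗ[ℂ] ℂ)

omit [CompleteSpace 𝔸] in
/-- **(2.16) for `⟨·, J_{k+1}⟩`**: `⟨R(u)𝐇, J(U^u_{k+1})⟩ = ⟨𝐇, J(U_{k+1})⟩` ((3.30) [13] `J^u = R(u)J`, r06's `bondPair_J_gaugeTr`).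
[cite: Balaban1987RG1, (2.16) p.269] [cite: Balaban1985BackgroundPropagators, (3.30) p.395] -/
theorem pairJ_gaugeTr (hT : ∀ μ ν x, T μ (T ν x) = T ν (T μ x)) (hτ : ∀ a b : 𝔸, τ (a * b) = τ (b * a))
    (u : S → 𝔸ˣ) (H : ι → S → 𝔸) :
    pairJ T (gaugeTr T u U₁) η d τ (rotB u H) = pairJ T U₁ η d τ H := by
  rw [pairJ_apply, pairJ_apply, bondPair_J_gaugeTr T U₁ hT τ hτ]

omit [CompleteSpace 𝔸] in
/-- **(2.16) for `⟨·, Δ·⟩`**: `⟨R(u)A, Δ(U^u_{k+1})R(u)B⟩ = ⟨A, Δ(U_{k+1})B⟩` — the operator form of (3.30) [13]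
(r06's `deltaOp_gaugeTr`: `Δ(U^u)(R(u)B) = R(u)(Δ(U)B)`) and the `R(u)`-invariance of the tracial pairing (`bondPair_rotB`).
[cite: Balaban1987RG1, (2.16) p.269] [cite: Balaban1985BackgroundPropagators, (3.30) p.395] -/
theorem hessForm_gaugeTr (hT : ∀ μ ν x, T μ (T ν x) = T ν (T μ x)) (hτ : ∀ a b : 𝔸, τ (a * b) = τ (b * a))
    (u : S → 𝔸ˣ) (A B : ι → S → 𝔸) :
    hessForm T (gaugeTr T u U₁) η d τ (rotB u A) (rotB u B) = hessForm T U₁ η d τ A B := by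
  have hΔ : deltaOp T (gaugeTr T u U₁) η (rotB u B) = rotB u (deltaOp T U₁ η B) := by
    funext μ x
    rw [deltaOp_gaugeTr T U₁ hT, rotB_apply]
  rw [hessForm_apply, hessForm_apply, hΔ, bondPair_rotB τ hτ]

/-- **(2.16) for the expanded action**: `A((R(u)U′)U^u_{k+1}) = A(U′U_{k+1})`, `U′ = exp iη𝐇` — «(R(u)U′)U^u = (U′U)^u»
(r06's `prodCfg_gaugeTr`) and (3.29). [cite: Balaban1987RG1, (2.16) p.269] [cite: Balaban1985BackgroundPropagators, (3.29) p.395] -/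
theorem actionZ_prodCfg_gaugeTr (hT : ∀ μ ν x, T μ (T ν x) = T ν (T μ x))
    (hτ : ∀ a b : 𝔸, τ (a * b) = τ (b * a)) (u : S → 𝔸ˣ) (H : ι → S → 𝔸) :
    actionZ T η d τ (prodCfg (gaugeTr T u U₁) η (rotB u H)) = actionZ T η d τ (prodCfg U₁ η H) := by
  rw [prodCfg_gaugeTr, actionZ_gaugeTr T hT τ hτ]

/-- **(2.16) FOR THE REMAINDER `V₀`** (the `V₀`-part of the V of (2.8); GAPS G-B12-09 (iii)): `V₀[U^u_{k+1}](R(u)𝐇) =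
V₀[U_{k+1}](𝐇)` — every other member of (41) [15] is invariant (`actionZ_prodCfg_gaugeTr`, `actionZ_gaugeTr`, `pairJ_gaugeTr`,
`hessForm_gaugeTr`), hence so is `V₀` (defined by (26) [15] as the remainder). [cite: Balaban1987RG1, (2.16) p.269, (2.8) p.266]
[cite: Balaban1985Variational, (26) p.282] [cite: Balaban1985BackgroundPropagators, (3.29)-(3.30) p.395] -/
theorem V0Z_gaugeTr (hT : ∀ μ ν x, T μ (T ν x) = T ν (T μ x)) (hτ : ∀ a b : 𝔸, τ (a * b) = τ (b * a))
    (u : S → 𝔸ˣ) (H : ι → S → 𝔸) :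
    V0Z T (gaugeTr T u U₁) η d τ (rotB u H) = V0Z T U₁ η d τ H := by
  have h1 := expansion41 T (gaugeTr T u U₁) τ hτ η d (rotB u H)
  have h2 := expansion41 T U₁ τ hτ η d H
  rw [actionZ_prodCfg_gaugeTr T U₁ η d τ hT hτ, actionZ_gaugeTr T hT τ hτ, pairJ_gaugeTr T U₁ η d τ hT hτ,
    hessForm_gaugeTr T U₁ η d τ hT hτ] at h1
  linear_combination h2 - h1

/-- **(2.16) for the right side of (41)/(2.6) as a whole**: with `𝐇 ↦ R(u)𝐇` and `U_{k+1} ↦ U^u_{k+1}` every member of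
`A(U_{k+1}) + ⟨𝐇, J_{k+1}⟩ + ½⟨𝐇, Δ𝐇⟩ + V₀(𝐇)` is unchanged («all the expressions … are invariant with respect to the gauge
transformations (2.16)», p. 269, for these letters). [cite: Balaban1987RG1, (2.16) p.269]
[cite: Balaban1985BackgroundPropagators, (3.29)-(3.30) p.395] -/
theorem expansion41_members_gaugeTr (hT : ∀ μ ν x, T μ (T ν x) = T ν (T μ x))
    (hτ : ∀ a b : 𝔸, τ (a * b) = τ (b * a)) (u : S → 𝔸ˣ) (H : ι → S → 𝔸) :
    actionZ T η d τ (gaugeTr T u U₁) = actionZ T η d τ U₁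
      ∧ pairJ T (gaugeTr T u U₁) η d τ (rotB u H) = pairJ T U₁ η d τ H
      ∧ hessForm T (gaugeTr T u U₁) η d τ (rotB u H) (rotB u H) = hessForm T U₁ η d τ H H
      ∧ V0Z T (gaugeTr T u U₁) η d τ (rotB u H) = V0Z T U₁ η d τ H :=
  ⟨actionZ_gaugeTr T hT τ hτ η d u U₁, pairJ_gaugeTr T U₁ η d τ hT hτ u H, hessForm_gaugeTr T U₁ η d τ hT hτ u H H,
    V0Z_gaugeTr T U₁ η d τ hT hτ u H⟩

omit [NormedAlgebra ℂ 𝔸] [CompleteSpace 𝔸] [Fintype S] [Fintype ι] [LinearOrder ι] in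
/-- `R(u)` is additive on bond fields ((2.16)'s `B′ → R(u)B′` is linear). [folklore] [cite: Balaban1987RG1, (2.16) p.269] -/
theorem rotB_add (u : S → 𝔸ˣ) (A B : ι → S → 𝔸) : rotB u (A + B) = rotB u A + rotB u B := by
  funext μ x
  simp only [rotB_apply, Pi.add_apply, R_add]

omit [NormedAlgebra ℂ 𝔸] [CompleteSpace 𝔸] [Fintype S] [Fintype ι] [LinearOrder ι] in
/-- `R(u)` respects differences of bond fields. [folklore] [cite: Balaban1987RG1, (2.16) p.269] -/
theorem rotB_sub (u : S → 𝔸ˣ) (A B : ι → S → 𝔸) : rotB u (A - B) = rotB u A - rotB u B := by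
  funext μ x
  simp only [rotB_apply, Pi.sub_apply, R_sub]

/-- **(2.16) FOR THE V OF (2.8)** (GAPS G-B12-09 (iii) for V, stated exactly): under `U_{k+1} → U^u_{k+1}`, `H₁B′ → R(u)H₁B′` the
function `V = Vlat` is INVARIANT, GIVEN the (2.16)-covariance of the [15]/[13] data — `𝒜₁` (`h𝒜`), `H_kD_k` (`hHD`), `H_kC^{(2)}`
(`hHC`), `Δ₁` (`hΔ₁`) — relating the data `D, 𝒜, H, D, C^{(2)}` at `U_{k+1}` to the data `D′, 𝒜′, H′, D′, C^{(2)}′` at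
`U^u_{k+1}` (NAMED INPUTS: the covariance of the [15] Sect. G / [13] Sect. D objects, rows B11.Eq174, B9.Eq3.127; both records
with `pairJ = ⟨·, J⟩` at their background, `hJ`, `hJ'`); the `V₀`, `⟨·, J⟩` and `⟨·, Δ·⟩` parts are the theorems `V0Z_gaugeTr`,
`pairJ_gaugeTr`, `hessForm_gaugeTr`. [cite: Balaban1987RG1, (2.16) p.269, (2.8) p.266]
[cite: Balaban1985BackgroundPropagators, (3.29)-(3.30) p.395] -/
theorem Vlat_gaugeTr {V X N : Type*} [AddCommGroup V] [Module ℂ V] [AddCommGroup X] [Module ℂ X] [AddCommGroup N]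
    [Module ℂ N] (hT : ∀ μ ν x, T μ (T ν x) = T ν (T μ x)) (hτ : ∀ a b : 𝔸, τ (a * b) = τ (b * a))
    (u : S → 𝔸ˣ) (D D' : Data ℂ V (ι → S → 𝔸) X) (hJ : D.pairJ = pairJ T U₁ η d τ)
    (hJ' : D'.pairJ = pairJ T (gaugeTr T u U₁) η d τ) (hΔ₁ : ∀ a b, D'.Δ₁ (rotB u a) (rotB u b) = D.Δ₁ a b)
    {𝒜 𝒜' : (ι → S → 𝔸) → (ι → S → 𝔸)} (h𝒜 : ∀ w, 𝒜' (rotB u w) = rotB u (𝒜 w))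
    {Hk Hk' : N →ₗ[ℂ] (ι → S → 𝔸)} {Dk Dk' C2 C2' : (ι → S → 𝔸) → N}
    (hHD : ∀ Y, Hk' (Dk' (rotB u Y)) = rotB u (Hk (Dk Y))) (hHC : ∀ Y, Hk' (C2' (rotB u Y)) = rotB u (Hk (C2 Y)))
    (w : ι → S → 𝔸) :
    Vlat T (gaugeTr T u U₁) η d τ D' 𝒜' Hk' Dk' C2' (rotB u w) = Vlat T U₁ η d τ D 𝒜 Hk Dk C2 w := by
  rw [Vlat_apply, Vlat_apply, hJ, hJ', h𝒜, ← rotB_add, map_sub Hk', map_sub Hk, hHD, hHC, ← rotB_sub, ← rotB_sub,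
    hΔ₁, pairJ_gaugeTr T U₁ η d τ hT hτ, hessForm_gaugeTr T U₁ η d τ hT hτ, hessForm_gaugeTr T U₁ η d τ hT hτ,
    V0Z_gaugeTr T U₁ η d τ hT hτ]

/-! ### §4c (v1.1)  `Vlat` is the record's `V28fn` at the dictionary (DEFINITIONS pair H40, r20 g48) -/

/-- **`Vlat` = the record's `V28fn`** (v1.1 of `B12ActionExpansion26`, p374484) at `β := hessForm`, `V₀ := V0Z`,
`D₃ := D − C^{(2)}` — by `rfl`; registered twin (r20's DEFINITIONS pair H40). [cite: Balaban1987RG1, (2.8) p.266] -/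
theorem Vlat_eq_V28fn {V X N : Type*} [AddCommGroup V] [Module ℂ V] [AddCommGroup X] [Module ℂ X] [AddCommGroup N]
    [Module ℂ N] (D : Data ℂ V (ι → S → 𝔸) X) (𝒜 : (ι → S → 𝔸) → (ι → S → 𝔸))
    (Hk : N →ₗ[ℂ] (ι → S → 𝔸)) (Dk C2 : (ι → S → 𝔸) → N) :
    Vlat T U₁ η d τ D 𝒜 Hk Dk C2
      = B12ActionExpansion26.V28fn D (hessForm T U₁ η d τ) (V0Z T U₁ η d τ) 𝒜 Hk Dk (fun Y => Dk Y - C2 Y) := rfl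

/-! ### §5b (v1.1)  (2.16) for `Δ₁` WITH BODY — the `hΔ₁` hypothesis of `Vlat_gaugeTr` reduced to the data `H_kC₂` -/

omit [CompleteSpace 𝔸] in
/-- **(2.16) FOR `Δ₁ = delta1Form`**: `Δ₁[U^u_{k+1}](R(u)A, R(u)B) = Δ₁[U_{k+1}](A, B)` GIVEN the (2.16)-covariance of the
[15]/[13] datum `H_kC₂` in polar form (`hHC₂`; the data at `U^u_{k+1}` primed) — the `⟨·, Δ·⟩` and `⟨·, J⟩` parts are the
theorems `hessForm_gaugeTr`, `pairJ_gaugeTr`.  This discharges the hypothesis `hΔ₁` of `Vlat_gaugeTr` for a lattice record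
with `Δ₁ := delta1Form` (`Vlat_gaugeTr_delta1Form`). [cite: Balaban1987RG1, (2.16) p.269, (2.7) p.266]
[cite: Balaban1985BackgroundPropagators, (3.30) p.395, (3.127) p.421] -/
theorem delta1Form_gaugeTr {N : Type*} [AddCommGroup N] [Module ℂ N] (hT : ∀ μ ν x, T μ (T ν x) = T ν (T μ x))
    (hτ : ∀ a b : 𝔸, τ (a * b) = τ (b * a)) (u : S → 𝔸ˣ) {Hk Hk' : N →ₗ[ℂ] (ι → S → 𝔸)}
    {C₂ C₂' : (ι → S → 𝔸) →ₗ[ℂ] (ι → S → 𝔸) →ₗ[ℂ] N}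
    (hHC₂ : ∀ a b, Hk' (C₂' (rotB u a) (rotB u b)) = rotB u (Hk (C₂ a b))) (a b : ι → S → 𝔸) :
    delta1Form T (gaugeTr T u U₁) η d τ Hk' C₂' (rotB u a) (rotB u b) = delta1Form T U₁ η d τ Hk C₂ a b := by
  rw [delta1Form_apply, delta1Form_apply, hHC₂, hessForm_gaugeTr T U₁ η d τ hT hτ, pairJ_gaugeTr T U₁ η d τ hT hτ]

/-- **(2.16) FOR THE V OF (2.8) WITH `Δ₁ = delta1Form`**: `Vlat_gaugeTr` with its `hΔ₁` hypothesis DISCHARGED by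
`delta1Form_gaugeTr` — the remaining NAMED covariances are those of the [15]/[13] data 𝒜₁ (`h𝒜`), `H_kD_k` (`hHD`), `H_kC^{(2)}`
(`hHC`) and the polar `H_kC₂` (`hHC₂`). [cite: Balaban1987RG1, (2.16) p.269, (2.8) p.266]
[cite: Balaban1985BackgroundPropagators, (3.29)-(3.30) p.395, (3.127) p.421] -/
theorem Vlat_gaugeTr_delta1Form {V X N : Type*} [AddCommGroup V] [Module ℂ V] [AddCommGroup X] [Module ℂ X]
    [AddCommGroup N] [Module ℂ N] (hT : ∀ μ ν x, T μ (T ν x) = T ν (T μ x)) (hτ : ∀ a b : 𝔸, τ (a * b) = τ (b * a))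
    (u : S → 𝔸ˣ) (D D' : Data ℂ V (ι → S → 𝔸) X) (hJ : D.pairJ = pairJ T U₁ η d τ)
    (hJ' : D'.pairJ = pairJ T (gaugeTr T u U₁) η d τ) {Hk Hk' : N →ₗ[ℂ] (ι → S → 𝔸)}
    {C₂ C₂' : (ι → S → 𝔸) →ₗ[ℂ] (ι → S → 𝔸) →ₗ[ℂ] N} (hΔ : D.Δ₁ = delta1Form T U₁ η d τ Hk C₂)
    (hΔ' : D'.Δ₁ = delta1Form T (gaugeTr T u U₁) η d τ Hk' C₂')
    (hHC₂ : ∀ a b, Hk' (C₂' (rotB u a) (rotB u b)) = rotB u (Hk (C₂ a b)))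
    {𝒜 𝒜' : (ι → S → 𝔸) → (ι → S → 𝔸)} (h𝒜 : ∀ w, 𝒜' (rotB u w) = rotB u (𝒜 w))
    {Dk Dk' C2 C2' : (ι → S → 𝔸) → N}
    (hHD : ∀ Y, Hk' (Dk' (rotB u Y)) = rotB u (Hk (Dk Y))) (hHC : ∀ Y, Hk' (C2' (rotB u Y)) = rotB u (Hk (C2 Y)))
    (w : ι → S → 𝔸) :
    Vlat T (gaugeTr T u U₁) η d τ D' 𝒜' Hk' Dk' C2' (rotB u w) = Vlat T U₁ η d τ D 𝒜 Hk Dk C2 w :=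
  Vlat_gaugeTr T U₁ η d τ hT hτ u D D' hJ hJ'
    (fun a b => by rw [hΔ, hΔ']; exact delta1Form_gaugeTr T U₁ η d τ hT hτ u hHC₂ a b) h𝒜 hHD hHC w

end GaugeInvariance

end Literature.MathematicalPhysics.QuantumFieldTheory.Balaban1983to89.B12ActionExpansion26Lattice

end
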